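import Summits.AtomisticToContinuum.HydrodynamicLimit.Theorems.CollisionIsometryCLTMacroClosureFvCubeToTorus
import HarnessLib

/-!
# The chart of a large torus cube: Haar volume of the constraint set

Stub `tl_chart` (thermodynamic-limit step) of the line `IdeatorTwoGen1Sketch` of the crux
`MacroClosure` (stmt-AtomisticToContinuum-14870): for a cube of side `S > 0` centred at
`c ∈ 𝕋³`, an exclusion distance `e > 0` with `S + e ≤ 1`, and `m` labelled points,

`vol {q : Fin m → 𝕋³ | every qᵢ lies in the cube, dist_𝕋(qᵢ, qⱼ) ≥ e for i ≠ j} =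
  vol {w : Fin m → ℝ³ | |wᵢₗ| ≤ S/2, ‖wᵢ - wⱼ‖ ≥ e for i ≠ j}`

(Haar probability measure on `(𝕋³)^m` on the left, Lebesgue measure on `(ℝ³)^m` on the right;
the cube is read in the chart `q ↦ reprSym (q - c)`, `dist_𝕋` is the minimal-image distance
`Torus.euclidDist`).

Proof. The chart `R q i := reprSym (qᵢ - c)` is measure preserving from Haar measure to Lebesgue
measure on `((-1/2, 1/2]³)^m` (`Torus.measurePreserving_reprSym`, translation invariance of Haar
measure, `measurePreserving_pi`), the Euclidean constraint set lies in that cube (`S/2 < 1/2`),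
and the torus constraint set is *exactly* the preimage of the Euclidean one under `R`. The chart
is not an isometry of a large cube, but the two constraints correspond: with
`w := R q i - R q j` (coordinates of modulus `≤ S ≤ 1 - e`) one has `qᵢ - qⱼ = proj w`, always
`‖reprSym (proj w)‖ ≤ ‖w‖` (`Torus.norm_reprSym_le_of_proj_eq`), and conversely if `‖w‖ ≥ e` then
either all `|wₗ| ≤ 1/2` and `reprSym (proj w)` has the coordinate moduli of `w`, or some
`|wₗ| > 1/2` and then `|reprSym (proj w) ₗ| = ‖(wₗ : ℝ/ℤ)‖ = 1 - |wₗ| ≥ 1 - S ≥ e`.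
-/

open MeasureTheory Filter Set Topology
open scoped ENNReal

namespace Summit.AtomisticToContinuum.HydrodynamicLimit.Theorems.MacroClosureLine

open Literature.MathematicalPhysics.KineticTheory Literature.Analysis.FluidPDE
open Literature.Analysis.FunctionSpaces

namespace Barycentric

namespace TlChart

/-- The distance to `ℤ` of a real number `t` with `1/2 < |t| ≤ 1` is `1 - |t|` (the nearest
integer is `±1`). [folklore] -/
theorem norm_coe_eq_one_sub_abs {t : ℝ} (h1 : 1 / 2 < |t|) (h2 : |t| ≤ 1) :
    ‖((t : ℝ) : UnitAddCircle)‖ = 1 - |t| := by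
  have key : ∀ s : ℝ, 1 / 2 < s → s ≤ 1 → ‖((s : ℝ) : UnitAddCircle)‖ = 1 - s := by
    intro s hs1 hs2
    have h := AddCircle.coe_add_period (1 : ℝ) (s - 1)
    rw [sub_add_cancel] at h
    rw [h, (AddCircle.norm_coe_eq_abs_iff (1 : ℝ) one_ne_zero).2, abs_of_nonpos (by linarith)]
    · ring
    · rw [abs_one, abs_of_nonpos (by linarith)]
      linarith
  rcases abs_choice t with h | h
  · rw [h] at h1 h2 ⊢
    exact key t h1 h2
  · have ht : ((t : ℝ) : UnitAddCircle) = -(((-t : ℝ)) : UnitAddCircle) := by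
      rw [AddCircle.coe_neg, neg_neg]
    rw [ht, norm_neg, h]
    rw [h] at h1 h2
    exact key (-t) h1 h2

variable {d : Type*} [Fintype d]

/-- If a vector `w ∈ ℝ^d` has all coordinates of modulus `≤ 1 - e` (`0 < e`) and norm `≥ e`, then
its projection to the torus is at minimal-image distance `≥ e` from `0`: either all coordinates
are at most `1/2` in modulus and the minimal image of `proj w` has the coordinate moduli of `w`, or
one coordinate `wₗ` has `1/2 < |wₗ| ≤ 1 - e` and already `‖(wₗ : ℝ/ℤ)‖ = 1 - |wₗ| ≥ e`. [folklore] -/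
theorem le_norm_reprSym_proj {w : EuclideanSpace ℝ d} {e : ℝ} (he : 0 < e)
    (hw : ∀ l, |w l| ≤ 1 - e) (hew : e ≤ ‖w‖) : e ≤ ‖Torus.reprSym (Torus.proj w)‖ := by
  by_cases hcase : ∀ l, |w l| ≤ 1 / 2
  · have hnorm : ‖Torus.reprSym (Torus.proj w)‖ = ‖w‖ := by
      rw [EuclideanSpace.norm_eq, EuclideanSpace.norm_eq]
      congr 1
      refine Finset.sum_congr rfl fun l _ => ?_
      rw [Real.norm_eq_abs, Real.norm_eq_abs, Torus.abs_reprSym_apply, Torus.proj_apply,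
        (AddCircle.norm_coe_eq_abs_iff (1 : ℝ) one_ne_zero).2]
      rw [abs_one]
      exact hcase l
    rw [hnorm]
    exact hew
  · push Not at hcase
    obtain ⟨l, hl⟩ := hcase
    calc e ≤ 1 - |w l| := by linarith [hw l]
      _ = ‖((w l : ℝ) : UnitAddCircle)‖ := (norm_coe_eq_one_sub_abs hl (by linarith [hw l])).symm
      _ = |Torus.reprSym (Torus.proj w) l| := by rw [Torus.abs_reprSym_apply, Torus.proj_apply]
      _ ≤ ‖Torus.reprSym (Torus.proj w)‖ := Torus.abs_reprSym_apply_le_norm _ l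

/-- **The constraints correspond under the chart.** In a torus cube of side `S` centred at `c`
with `S + e ≤ 1`, `0 < e`, two points `a, b` are at minimal-image distance `≥ e` iff their chart
images `reprSym (a - c)`, `reprSym (b - c)` are at Euclidean distance `≥ e`. [folklore] -/
theorem le_norm_sub_iff {a b c : UnitAddTorus d} {S e : ℝ} (he : 0 < e) (hSe : S + e ≤ 1)
    (ha : ∀ l, |Torus.reprSym (a - c) l| ≤ S / 2) (hb : ∀ l, |Torus.reprSym (b - c) l| ≤ S / 2) :
    e ≤ ‖Torus.reprSym (a - c) - Torus.reprSym (b - c)‖ ↔ e ≤ Torus.euclidDist a b := by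
  set w := Torus.reprSym (a - c) - Torus.reprSym (b - c) with hw
  have hab : a - b = Torus.proj w := by
    rw [hw, show Torus.proj (Torus.reprSym (a - c) - Torus.reprSym (b - c)) =
      Torus.proj (Torus.reprSym (a - c)) - Torus.proj (Torus.reprSym (b - c)) from rfl,
      Torus.proj_reprSym, Torus.proj_reprSym, sub_sub_sub_cancel_right]
  have hwl : ∀ l, |w l| ≤ 1 - e := fun l => by
    rw [hw, PiLp.sub_apply]
    have h1 := abs_le.1 (ha l)
    have h2 := abs_le.1 (hb l)
    rw [abs_le]
    constructor <;> linarith [h1.1, h1.2, h2.1, h2.2]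
  rw [Torus.euclidDist_eq, hab]
  exact ⟨le_norm_reprSym_proj he hwl, fun h => h.trans (Torus.norm_reprSym_le_of_proj_eq rfl)⟩

end TlChart

open FvCubeToTorus TlChart in
/-- **The chart of a large torus cube (thermodynamic-limit step, `tl_chart`).** For a cube of
side `S > 0` centred at `c ∈ 𝕋³` and an exclusion distance `e > 0` with `S + e ≤ 1`, the Haar
measure of the set of `m` labelled points of the cube (read in the chart `q ↦ reprSym (q - c)`)
that are pairwise at minimal-image distance `≥ e` equals the Lebesgue measure of the set of `m`
points of `[-S/2, S/2]³` pairwise at Euclidean distance `≥ e`: the chart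
`q ↦ (reprSym (qᵢ - c))ᵢ` is measure preserving onto Lebesgue measure on `((-1/2, 1/2]³)^m`
and, although it is not an isometry of a large cube, the torus constraint set is exactly the
preimage of the Euclidean one (`TlChart.le_norm_sub_iff`). [folklore] -/
theorem tl_chart : ∀ (m : ℕ) (c : T3) (S e : ℝ), 0 < S → 0 < e → S + e ≤ 1 → volume {q : Fin m → T3 | (∀ i l, |Torus.reprSym (q i - c) l| ≤ S / 2) ∧ ∀ i j, i ≠ j → e ≤ Torus.euclidDist (q i) (q j)} = volume {w : Fin m → V3 | (∀ i l, |w i l| ≤ S / 2) ∧ ∀ i j, i ≠ j → e ≤ ‖w i - w j‖} := by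
  intro m c S e _hS he hSe
  have hR : MeasurePreserving (fun (x : Fin m → T3) (i : Fin m) => Torus.reprSym (x i - c))
      (volume : Measure (Fin m → T3))
      (Measure.pi fun _ : Fin m => (volume : Measure V3).restrict (Torus.symCube (Fin 3))) :=
    measurePreserving_pi (fun _ : Fin m => (volume : Measure T3))
      (fun _ => (volume : Measure V3).restrict (Torus.symCube (Fin 3)))
      (f := fun (_ : Fin m) (y : T3) => Torus.reprSym (y - c))
      fun _ => Torus.measurePreserving_reprSym.comp (measurePreserving_sub_right volume c)
  have hQmeas : MeasurableSet (Set.univ.pi fun _ : Fin m => Torus.symCube (Fin 3)) :=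
    MeasurableSet.univ_pi fun _ => Torus.measurableSet_symCube
  have hVQ : {w : Fin m → V3 | (∀ i l, |w i l| ≤ S / 2) ∧ ∀ i j, i ≠ j → e ≤ ‖w i - w j‖} ⊆
      Set.univ.pi fun _ : Fin m => Torus.symCube (Fin 3) := by
    intro v hv
    refine Set.mem_univ_pi.2 fun i l => ?_
    have h1 := abs_le.1 (hv.1 i l)
    exact ⟨by linarith [h1.1], by linarith [h1.2]⟩
  symm
  rw [← inter_eq_left.2 hVQ, ← Measure.restrict_apply' hQmeas,
    show (volume : Measure (Fin m → V3)) = Measure.pi fun _ => volume from rfl,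
    Measure.restrict_pi_pi,
    ← hR.measure_preimage (measurableSet_constraint m (S / 2) e).nullMeasurableSet]
  congr 1
  ext x
  simp only [Set.mem_preimage, Set.mem_setOf_eq]
  refine and_congr_right fun hx => forall_congr' fun i => forall_congr' fun j =>
    imp_congr_right fun _ => ?_
  exact le_norm_sub_iff he hSe (hx i) (hx j)

end Barycentric

end Summit.AtomisticToContinuum.HydrodynamicLimit.Theorems.MacroClosureLine
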